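import Summits.ABC.IUTFork.Thm311RealIsmDHDistortion
import Literature.IUT.LogVolume.LogRadius
import HarnessLib

/-!
# [IUTchIII] Thm 3.11 (i) at `v ∈ 𝕍^non`: the bi-Lipschitz constant of Dupuy–Hilado's `Aut_{ℚ_p}(K_v : I_v)` made
# EXPLICIT — `C_v = p^{1 + a_e + b_e}` from the two radii of [IUTchIV] Prop 1.2 (i); `C_v = p` at tame places

PROOF-ONLY file (abc-iut cell, Cor. 3.12 sub-crew, Team R lineage seat abc-iut-w5-d216 gen 7; row «EXPLICIT-CV» = item (3)
of the OPEN list of the holder of record of the typed [IUTchIII] Thm. 3.11, abc-iut-c312-1 gen 10).  TAKES NO SIDE on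
[IUTchIII] Cor. 3.12.  No `def`, no named fact; classical `p`-adic analysis on the cell's typings.

p485448 `Thm311RealIsmDHDistortion` proves that every `φ ∈ Real.ismDH (analyticLogv F) v` (Dupuy–Hilado's bicontinuous
`ℚ`-linear automorphisms of `K_v` with `φ(I_v) = I_v`; the family CONTAINS print's (Ind1) strip part and print's (Ind2))
satisfies `‖φ x‖ ≤ C_v ‖x‖` for ONE constant `C_v = p · max_{I_v} ‖·‖`, found by compactness — an EXISTENTIAL constant.
Here it is COMPUTED.  `I_v = (p*)⁻¹ · log_p(𝒪_v^×)` ([AbsTopIII] Def. 5.4 (iii), `logShell_ofUnitLog`) and [IUTchIV]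
Prop. 1.2 (i) (abc-iut-S1 `prop12i_holds`) brackets `log_p(𝒪_v^×)` between two balls, `p^{a_e}·𝒪_v ⊆ log_p(𝒪_v^×) ⊆ p^{−b_e}·𝒪_v`
(`a_e = logRadiusA p e`, `b_e = logRadiusB p e`, `e = e(v|p)`).  §1: `B(0, ‖p*‖⁻¹p^{−a_e}) ⊆ I_v ⊆ B(0, ‖p*‖⁻¹p^{b_e})`
and the arithmetic of the exponent (`1 + a_e + b_e > 0`; `= 1` when `p > 2`, `e ≤ p − 2`; `≤ 4 + log e/log p` always).
§2: running p485448's scaling argument between the INNER and the OUTER radius gives **`norm_map_le_pow_of_mem_ismDH`**: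
`‖φ x‖ ≤ p^{1 + a_e + b_e} · ‖x‖` for EVERY `φ ∈ Real.ismDH (analyticLogv F) v`, every `x ∈ K_v` (rescaled norm of abc-iut-S7;
`‖p*‖⁻¹` cancels), its two-sided and ball forms, and the same for print's (Ind1) strip part.  §3: at a TAME place (`p` odd,
`e(v|p) ≤ p − 2`, where `log_p(𝒪_v^×) = 𝔪_v` and `I_v` is a ball) **`C_v = p`** (`norm_map_le_prime_mul_of_mem_ismDH_of_tame`).
§4: the same in print's currency `e(v|p) = v.asIdeal.ramificationIdx ℤ`, and the uniform crude bound **`C_v ≤ p⁴ · e(v|p)`**.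
So the bracket of record for print's (Ind1)/(Ind2) at a finite place reads, with numbers: not region-rigid (p482234, modulo
Jannsen–Wingberg; index `≥ p` per window, p484887) but inflating radii by at most `p^{1+a_e+b_e}` (`= p` tame; `= 1` at
unramified / degree-one places, p428821 / p429240).  Classical; [cite: DupuyHilado2025, §4.9]; [claim: Mochizuki2012, status: disputed]
for every [IUTchIII]/[IUTchIV] quotation; typed ≠ proved; nothing here asserts abc proved or refuted.
-/

noncomputable section

open Metric Set Function
open scoped Pointwise

namespace Summit.ABC.IUTFork.Thm311.Real

open Literature.IUT.LogVolume Literature.NumberTheory.NumberFields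
open Literature.NumberTheory.GaloisRepresentations.Ultrametric
open Literature.AnabelianGeometry.AbsoluteAnabelian
open NumberField IsDedekindDomain

/-! ## §1. Inner and outer radius of the log-shell `I = (p*)⁻¹ · log_p(𝒪^×)` of a `p`-adic field -/

section Radii

variable (p : ℕ) [Fact p.Prime] (K : Type*) [NontriviallyNormedField K] [NormedAlgebra ℚ_[p] K]
  [IsUltrametricDist K] [ProperSpace K]

/-- **Inner radius of the log-shell.**  `B(0, ‖p*‖⁻¹ · p^{−a_e}) ⊆ I_K = (p*)⁻¹ · log_p(𝒪_K^×)`, from the lower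
inclusion `p^{a_e}·𝒪_K ⊆ log_p(𝒪_K^×)` of [IUTchIV] Prop. 1.2 (i) (`pBall_logRadiusA_subset_logUnits`).
[claim: Mochizuki2012, status: disputed] [cite: MochizukiAbsTopIII2015, Def 5.4 (iii) p. 126] -/
theorem closedBall_inner_subset_logShell_ofUnitLog :
    closedBall (0 : K) (‖(PadicLogOnUnits.ofUnitLog p K).pstar‖⁻¹ *
        (p : ℝ) ^ (-logRadiusA p (absRamificationIdx p K))) ⊆
      logShell (PadicLogOnUnits.ofUnitLog p K) := by
  have h := Set.smul_set_mono (a := ((PadicLogOnUnits.ofUnitLog p K).pstar)⁻¹)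
    ((pBall_eq_closedBall p K _) ▸ pBall_logRadiusA_subset_logUnits p K)
  rw [smul_closedBall' (inv_ne_zero (PadicLogOnUnits.ofUnitLog p K).pstar_ne_zero), smul_zero, norm_inv] at h
  rwa [logShell, preLogShell_ofUnitLog]

/-- **Outer radius of the log-shell.**  `I_K = (p*)⁻¹ · log_p(𝒪_K^×) ⊆ B(0, ‖p*‖⁻¹ · p^{b_e})`, from the upper
inclusion `log_p(𝒪_K^×) ⊆ p^{−b_e}·𝒪_K` of [IUTchIV] Prop. 1.2 (i) (`logUnits_subset_pBall_neg_logRadiusB`).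
[claim: Mochizuki2012, status: disputed] [cite: MochizukiAbsTopIII2015, Def 5.4 (iii) p. 126] -/
theorem logShell_ofUnitLog_subset_closedBall_outer :
    logShell (PadicLogOnUnits.ofUnitLog p K) ⊆
      closedBall (0 : K) (‖(PadicLogOnUnits.ofUnitLog p K).pstar‖⁻¹ *
        (p : ℝ) ^ (logRadiusB p (absRamificationIdx p K))) := by
  have h := logUnits_subset_pBall_neg_logRadiusB p K
  rw [pBall_eq_closedBall, neg_neg] at h
  have h2 := Set.smul_set_mono (a := ((PadicLogOnUnits.ofUnitLog p K).pstar)⁻¹) h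
  rw [smul_closedBall' (inv_ne_zero (PadicLogOnUnits.ofUnitLog p K).pstar_ne_zero), smul_zero, norm_inv] at h2
  rwa [logShell, preLogShell_ofUnitLog]

/-- The inner radius is positive. [folklore] -/
theorem inner_radius_pos :
    0 < ‖(PadicLogOnUnits.ofUnitLog p K).pstar‖⁻¹ * (p : ℝ) ^ (-logRadiusA p (absRamificationIdx p K)) := by
  have hp0 : (0 : ℝ) < p := by exact_mod_cast (Fact.out : p.Prime).pos
  exact mul_pos (inv_pos.mpr (norm_pos_iff.mpr (PadicLogOnUnits.ofUnitLog p K).pstar_ne_zero))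
    (Real.rpow_pos_of_pos hp0 _)

/-- The ratio `p · (outer radius) / (inner radius)` is `p^{1 + a_e + b_e}` (the factor `‖p*‖⁻¹` cancels). [folklore] -/
theorem prime_mul_outer_div_inner_eq (e : ℕ) (ρ : ℝ) (hρ : 0 < ρ) :
    (p : ℝ) * (ρ * (p : ℝ) ^ (logRadiusB p e)) / (ρ * (p : ℝ) ^ (-logRadiusA p e)) =
      (p : ℝ) ^ (1 + logRadiusA p e + logRadiusB p e) := by
  have hp0 : (0 : ℝ) < p := by exact_mod_cast (Fact.out : p.Prime).pos
  rw [mul_div_assoc, mul_div_mul_left _ _ hρ.ne', ← Real.rpow_sub hp0,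
    show (1 : ℝ) + logRadiusA p e + logRadiusB p e = 1 + (logRadiusB p e - -logRadiusA p e) by ring,
    Real.rpow_add hp0, Real.rpow_one]

/-! ### Arithmetic of the exponent `1 + a_e + b_e` -/

/-- The explicit exponent is positive: `a_e > 1/(p−1) > 0` (`one_div_lt_logRadiusA`) and `b_e ≥ −1/e ≥ −1`
(`floor_logRadius_nonneg`), so `1 + a_e + b_e > 0` and `p^{1+a_e+b_e} ≥ 1`. [claim: Mochizuki2012, status: disputed] -/
theorem one_le_pow_one_add_logRadiusA_add_logRadiusB {e : ℕ} (he : 1 ≤ e) :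
    (1 : ℝ) ≤ (p : ℝ) ^ (1 + logRadiusA p e + logRadiusB p e) := by
  have hP : p.Prime := Fact.out
  have hp1 : (1 : ℝ) ≤ p := by exact_mod_cast hP.one_lt.le
  have hp1' : (1 : ℝ) < p := by exact_mod_cast hP.one_lt
  refine Real.one_le_rpow hp1 ?_
  have ha : 0 < logRadiusA p e :=
    lt_trans (one_div_pos.mpr (by linarith)) (one_div_lt_logRadiusA p he)
  have hb : -1 ≤ logRadiusB p e := by
    unfold logRadiusB
    have h0 : (0 : ℝ) ≤ (⌊Real.log ((p : ℝ) * e / ((p : ℝ) - 1)) / Real.log p⌋ : ℝ) := by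
      exact_mod_cast floor_logRadius_nonneg p he
    have he' : (1 : ℝ) ≤ e := by exact_mod_cast he
    have h1 : 1 / (e : ℝ) ≤ 1 := (div_le_one (by linarith)).mpr he'
    linarith
  linarith

omit [Fact p.Prime] in
/-- At a tame place the exponent collapses: `p > 2`, `1 ≤ e ≤ p − 2` ⇒ `1 + a_e + b_e = 1` (`a_e = 1/e = −b_e`,
[IUTchIV] Prop. 1.2: "if `p > 2` and `e ≤ p−2`, then `a = 1/e = −b`"). [claim: Mochizuki2012, status: disputed] -/
theorem one_add_logRadiusA_add_logRadiusB_eq_one_of_tame {e : ℕ} (hp2 : 2 < p) (he₁ : 1 ≤ e) (he : e ≤ p - 2) :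
    1 + logRadiusA p e + logRadiusB p e = 1 := by
  rw [logRadiusA_eq hp2 he₁ he, logRadiusB_eq hp2 he₁ he]
  ring

/-- Crude size of the exponent: `1 + a_e + b_e ≤ 4 + log e / log p` (`a_e ≤ 2`, `b_e ≤ log(p·e/(p−1))/log p ≤ 1 + log e/log p`).
[claim: Mochizuki2012, status: disputed] -/
theorem one_add_logRadiusA_add_logRadiusB_le {e : ℕ} (he : 1 ≤ e) :
    1 + logRadiusA p e + logRadiusB p e ≤ 4 + Real.log e / Real.log p := by
  have hP : p.Prime := Fact.out
  have hp2 : (2 : ℝ) ≤ p := by exact_mod_cast hP.two_le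
  have hp1 : (1 : ℝ) < p := by linarith
  have hp0 : (0 : ℝ) < p := by linarith
  have he' : (1 : ℝ) ≤ e := by exact_mod_cast he
  have he0 : (0 : ℝ) < e := by linarith
  have hlogp : 0 < Real.log p := Real.log_pos hp1
  -- `a ≤ 2`
  have ha : logRadiusA p e ≤ 2 := by
    unfold logRadiusA
    split_ifs with h2
    · exact le_rfl
    · have hp3 : (3 : ℝ) ≤ p := by
        have : 3 ≤ p := by have := hP.two_le; omega
        exact_mod_cast this
      have hceil : (⌈(e : ℝ) / ((p : ℝ) - 2)⌉ : ℝ) ≤ e := by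
        have h1 : (e : ℝ) / ((p : ℝ) - 2) ≤ (e : ℤ) := by
          rw [div_le_iff₀ (by linarith)]
          push_cast
          nlinarith
        have h2' := Int.ceil_le.mpr h1
        exact_mod_cast h2'
      calc (⌈(e : ℝ) / ((p : ℝ) - 2)⌉ : ℝ) / e ≤ (e : ℝ) / e := by gcongr
        _ = 1 := div_self he0.ne'
        _ ≤ 2 := by norm_num
  -- `b ≤ 1 + log e / log p`
  have hb : logRadiusB p e ≤ 1 + Real.log e / Real.log p := by
    unfold logRadiusB
    have hfl : (⌊Real.log ((p : ℝ) * e / ((p : ℝ) - 1)) / Real.log p⌋ : ℝ) ≤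
        Real.log ((p : ℝ) * e / ((p : ℝ) - 1)) / Real.log p := Int.floor_le _
    have hx : (p : ℝ) * e / ((p : ℝ) - 1) ≤ p * e := by
      rw [div_le_iff₀ (by linarith)]
      have hpe : (0 : ℝ) ≤ (p : ℝ) * e := by positivity
      nlinarith [mul_nonneg hpe (show (0 : ℝ) ≤ (p : ℝ) - 2 by linarith)]
    have hxpos : 0 < (p : ℝ) * e / ((p : ℝ) - 1) := div_pos (mul_pos hp0 he0) (by linarith)
    have hlog : Real.log ((p : ℝ) * e / ((p : ℝ) - 1)) ≤ Real.log p + Real.log e := by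
      rw [← Real.log_mul hp0.ne' he0.ne']
      exact Real.log_le_log hxpos hx
    have h3 : Real.log ((p : ℝ) * e / ((p : ℝ) - 1)) / Real.log p ≤ 1 + Real.log e / Real.log p := by
      rw [div_le_iff₀ hlogp, add_mul, one_mul, div_mul_cancel₀ _ hlogp.ne']
      exact hlog
    have h4 : 0 ≤ 1 / (e : ℝ) := by positivity
    linarith
  linarith

/-- **Uniform crude bound**: `p^{1 + a_e + b_e} ≤ p⁴ · e`. [claim: Mochizuki2012, status: disputed] -/
theorem pow_one_add_logRadiusA_add_logRadiusB_le {e : ℕ} (he : 1 ≤ e) :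
    (p : ℝ) ^ (1 + logRadiusA p e + logRadiusB p e) ≤ (p : ℝ) ^ (4 : ℕ) * e := by
  have hP : p.Prime := Fact.out
  have hp1 : (1 : ℝ) < p := by exact_mod_cast hP.one_lt
  have hp0 : (0 : ℝ) < p := by linarith
  have he0 : (0 : ℝ) < e := by exact_mod_cast he
  calc (p : ℝ) ^ (1 + logRadiusA p e + logRadiusB p e)
      ≤ (p : ℝ) ^ (4 + Real.log e / Real.log p) :=
        Real.rpow_le_rpow_of_exponent_le hp1.le (one_add_logRadiusA_add_logRadiusB_le p he)
    _ = (p : ℝ) ^ (4 : ℝ) * (p : ℝ) ^ (Real.logb p e) := by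
        rw [Real.rpow_add hp0]; rfl
    _ = (p : ℝ) ^ (4 : ℕ) * e := by
        rw [Real.rpow_logb hp0 hp1.ne' he0, show (4 : ℝ) = ((4 : ℕ) : ℝ) by norm_num, Real.rpow_natCast]

end Radii

/-! ## §2. The explicit Lipschitz constant `C_v = p^{1 + a_e + b_e}` for `Real.ismDH (analyticLogv F) v` -/

section Explicit

variable {F : Type} [Field F] [NumberField F] (p : ℕ) [Fact p.Prime] (v : HeightOneSpectrum (𝓞 F))
  (hv : ((p : ℕ) : 𝓞 F) ∈ v.asIdeal)

/-- **EXPLICIT UNIFORM LIPSCHITZ BOUND for Dupuy–Hilado's `Aut_{ℚ_p}(K_v : I_v)`.**  With `e = e(v|p)` the absolute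
ramification index of `K_v` and `a_e = logRadiusA p e`, `b_e = logRadiusB p e` the radii of [IUTchIV] Prop. 1.2 (i), EVERY
`φ ∈ Real.ismDH (analyticLogv F) v` satisfies `‖φ x‖ ≤ p^{1 + a_e + b_e} · ‖x‖` for all `x ∈ K_v` (rescaled norm of
abc-iut-S7).  Proof: `φ` is `ℚ_p`-linear by continuity (`IsmDHUnram.map_smul_of_continuous`); scale `x ≠ 0` by
`c = p^{n+1}` into the INNER ball `B(0, ‖p*‖⁻¹p^{−a_e}) ⊆ I_v`, apply `φ(I_v) = I_v` and the OUTER radius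
`I_v ⊆ B(0, ‖p*‖⁻¹p^{b_e})`. [cite: DupuyHilado2025, §4.9] [claim: Mochizuki2012, status: disputed] -/
theorem norm_map_le_pow_of_mem_ismDH (hp : residueChar F v = p)
    {φ : Carrier (.inr v : Place F) ≃ₗ[ℚ] Carrier (.inr v : Place F)}
    (hφ : φ ∈ ismDH (analyticLogv F) (.inr v : Place F)) (x : Carrier (.inr v : Place F)) :
    ‖RescaledCompletion.of F p v hv (φ x)‖ ≤
      (p : ℝ) ^ (1 + logRadiusA p (absRamificationIdx p (RescaledCompletion F p v hv)) +
          logRadiusB p (absRamificationIdx p (RescaledCompletion F p v hv))) *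
        ‖RescaledCompletion.of F p v hv x‖ := by
  subst hp
  set K := RescaledCompletion F (residueChar F v) v hv
  let e : Carrier (.inr v : Place F) ≃+* K := RescaledCompletion.of F (residueChar F v) v hv
  have hP : (residueChar F v).Prime := Fact.out
  have hp1 : (1 : ℝ) < residueChar F v := by exact_mod_cast hP.one_lt
  have hp0 : (0 : ℝ) < residueChar F v := lt_trans zero_lt_one hp1
  -- the shell, read on `K`
  have hshell : shell (analyticLogv F) (.inr v) =
      e.symm '' logShell (PadicLogOnUnits.ofUnitLog (residueChar F v) K) :=
    shell_eq_image_logShell_of_formula (residueChar F v) v hv (analyticLogv F) rfl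
      (fun u => analyticLogv_apply F v u)
  set B : Set K := logShell (PadicLogOnUnits.ofUnitLog (residueChar F v) K) with hBdef
  -- inner radius `r`, outer radius `R`
  set ρ : ℝ := ‖(PadicLogOnUnits.ofUnitLog (residueChar F v) K).pstar‖⁻¹ with hρdef
  set r : ℝ := ρ * (residueChar F v : ℝ) ^ (-logRadiusA (residueChar F v) (absRamificationIdx (residueChar F v) K))
    with hrdef
  set R : ℝ := ρ * (residueChar F v : ℝ) ^ (logRadiusB (residueChar F v) (absRamificationIdx (residueChar F v) K))
    with hRdef
  have hρ0 : 0 < ρ :=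
    inv_pos.mpr (norm_pos_iff.mpr (PadicLogOnUnits.ofUnitLog (residueChar F v) K).pstar_ne_zero)
  have hr0 : 0 < r := inner_radius_pos (residueChar F v) K
  have hball : ∀ y : K, ‖y‖ ≤ r → y ∈ B := by
    intro y hy
    exact closedBall_inner_subset_logShell_ofUnitLog (residueChar F v) K (mem_closedBall_zero_iff.mpr hy)
  have hout : ∀ z ∈ B, ‖z‖ ≤ R := by
    intro z hz
    exact mem_closedBall_zero_iff.mp (logShell_ofUnitLog_subset_closedBall_outer (residueChar F v) K hz)
  have hC : (residueChar F v : ℝ) * R / r = (residueChar F v : ℝ) ^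
      (1 + logRadiusA (residueChar F v) (absRamificationIdx (residueChar F v) K) +
        logRadiusB (residueChar F v) (absRamificationIdx (residueChar F v) K)) :=
    prime_mul_outer_div_inner_eq (residueChar F v) _ ρ hρ0
  rw [← hC]
  obtain ⟨hc, -, himg⟩ := hφ
  -- `φ` read on `K`
  let f : K →+ K := (e.symm.toAddEquiv.trans (φ.toAddEquiv.trans e.toAddEquiv)).toAddMonoidHom
  have hfc : Continuous f := hc
  have hB : f '' B = B := by
    have h1 : f '' B = e '' (⇑φ '' (e.symm '' B)) := by
      rw [Set.image_image, Set.image_image]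
      rfl
    rw [h1, ← hshell, himg, hshell, Set.image_image]
    simp only [RingEquiv.apply_symm_apply, Set.image_id']
  have hfx : RescaledCompletion.of F (residueChar F v) v hv (φ x) = f (e x) := by
    change e (φ x) = e (φ (e.symm (e x)))
    rw [e.symm_apply_apply]
  rw [hfx]
  change ‖f (e x)‖ ≤ (residueChar F v : ℝ) * R / r * ‖e x‖
  set y : K := e x with hy
  by_cases hy0 : y = 0
  · rw [hy0, map_zero, norm_zero, mul_zero]
  · -- scale `y` into the inner ball: `p^n < ‖y‖/r ≤ p^{n+1}`, `c = p^{n+1}`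
    obtain ⟨n, hn1, hn2⟩ := exists_mem_Ioc_zpow (div_pos (norm_pos_iff.mpr hy0) hr0) hp1
    set c : ℚ_[residueChar F v] := (residueChar F v : ℚ_[residueChar F v]) ^ (n + 1) with hcdef
    have hcnorm : ‖c‖ = ((residueChar F v : ℝ) ^ (n + 1))⁻¹ := by
      rw [hcdef, norm_zpow, Padic.norm_p, inv_zpow]
    have hcy : ‖c • y‖ ≤ r := by
      rw [norm_smul, hcnorm, inv_mul_le_iff₀ (zpow_pos hp0 _)]
      rw [div_le_iff₀ hr0] at hn2
      exact hn2
    have hfcy : f (c • y) ∈ B := by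
      rw [← hB]; exact Set.mem_image_of_mem f (hball _ hcy)
    have hle : ‖f (c • y)‖ ≤ R := hout _ hfcy
    rw [IsmDHUnram.map_smul_of_continuous f hfc c y, norm_smul, hcnorm, inv_mul_le_iff₀ (zpow_pos hp0 _)] at hle
    -- `‖f y‖ ≤ p^{n+1} R = p · (p^n · R) ≤ p · (‖y‖/r) · R`
    have hn1' : (residueChar F v : ℝ) ^ n * R ≤ ‖y‖ / r * R :=
      mul_le_mul_of_nonneg_right hn1.le (le_trans (norm_nonneg _) (hout _ hfcy))
    calc ‖f y‖ ≤ (residueChar F v : ℝ) ^ (n + 1) * R := hle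
      _ = (residueChar F v : ℝ) * ((residueChar F v : ℝ) ^ n * R) := by
          rw [zpow_add_one₀ hp0.ne']; ring
      _ ≤ (residueChar F v : ℝ) * (‖y‖ / r * R) := mul_le_mul_of_nonneg_left hn1' hp0.le
      _ = (residueChar F v : ℝ) * R / r * ‖y‖ := by
          field_simp

/-- **EXPLICIT BI-LIPSCHITZ**: with the same explicit constant, `‖x‖ ≤ p^{1+a_e+b_e} · ‖φ x‖` as well (the bound
applied to `φ⁻¹ ∈ Real.ismDH`, `symm_mem_ismDH`). [cite: DupuyHilado2025, §4.9] [claim: Mochizuki2012, status: disputed] -/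
theorem norm_le_pow_mul_norm_map_of_mem_ismDH (hp : residueChar F v = p)
    {φ : Carrier (.inr v : Place F) ≃ₗ[ℚ] Carrier (.inr v : Place F)}
    (hφ : φ ∈ ismDH (analyticLogv F) (.inr v : Place F)) (x : Carrier (.inr v : Place F)) :
    ‖RescaledCompletion.of F p v hv x‖ ≤
      (p : ℝ) ^ (1 + logRadiusA p (absRamificationIdx p (RescaledCompletion F p v hv)) +
          logRadiusB p (absRamificationIdx p (RescaledCompletion F p v hv))) *
        ‖RescaledCompletion.of F p v hv (φ x)‖ := by
  have h := norm_map_le_pow_of_mem_ismDH p v hv hp (symm_mem_ismDH v hφ) (φ x)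
  rwa [LinearEquiv.symm_apply_apply] at h

/-- **EXPLICIT BOUNDED INFLATION OF EVERY BALL**: every `φ ∈ Real.ismDH (analyticLogv F) v` maps `B(0, r)` into
`B(0, p^{1+a_e+b_e} · r)` (rescaled norm, read through the identity `of`). [cite: DupuyHilado2025, §4.9]
[claim: Mochizuki2012, status: disputed] -/
theorem image_closedBall_subset_pow_of_mem_ismDH (hp : residueChar F v = p)
    {φ : Carrier (.inr v : Place F) ≃ₗ[ℚ] Carrier (.inr v : Place F)}
    (hφ : φ ∈ ismDH (analyticLogv F) (.inr v : Place F)) (r : ℝ) :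
    (fun y => RescaledCompletion.of F p v hv (φ ((RescaledCompletion.of F p v hv).symm y))) ''
        closedBall (0 : RescaledCompletion F p v hv) r ⊆
      closedBall (0 : RescaledCompletion F p v hv)
        ((p : ℝ) ^ (1 + logRadiusA p (absRamificationIdx p (RescaledCompletion F p v hv)) +
            logRadiusB p (absRamificationIdx p (RescaledCompletion F p v hv))) * r) := by
  rintro _ ⟨y, hy, rfl⟩
  rw [mem_closedBall_zero_iff] at hy ⊢
  have h := norm_map_le_pow_of_mem_ismDH p v hv hp hφ ((RescaledCompletion.of F p v hv).symm y)
  rw [RingEquiv.apply_symm_apply] at h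
  exact h.trans (mul_le_mul_of_nonneg_left hy (le_trans zero_le_one
    (one_le_pow_one_add_logRadiusA_add_logRadiusB p (absRamificationIdx_pos p (RescaledCompletion F p v hv)))))

/-- **PRINT'S (Ind1) STRIP PART INFLATES BY AT MOST `p^{1+a_e+b_e}`** (unconditional, explicit): every element of
`Real.ind1Strip (analyticLogv F) v` maps `B(0,r)` into `B(0, p^{1+a_e+b_e}·r)` (`Real.ind1Strip_subset_ismDH` + §2).
[claim: Mochizuki2012, status: disputed] [cite: DupuyHilado2025, §4.9] -/
theorem image_closedBall_subset_pow_of_mem_ind1Strip (hp : residueChar F v = p)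
    {ψ : Carrier (.inr v : Place F) ≃ₗ[ℚ] Carrier (.inr v : Place F)}
    (hψ : ψ ∈ ind1Strip (analyticLogv F) v) (r : ℝ) :
    (fun y => RescaledCompletion.of F p v hv (ψ ((RescaledCompletion.of F p v hv).symm y))) ''
        closedBall (0 : RescaledCompletion F p v hv) r ⊆
      closedBall (0 : RescaledCompletion F p v hv)
        ((p : ℝ) ^ (1 + logRadiusA p (absRamificationIdx p (RescaledCompletion F p v hv)) +
            logRadiusB p (absRamificationIdx p (RescaledCompletion F p v hv))) * r) :=
  image_closedBall_subset_pow_of_mem_ismDH p v hv hp (ind1Strip_subset_ismDH (analyticLogv F) v hψ) r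

/-! ## §3. Tame places (`p` odd, `e(v|p) ≤ p − 2`): `C_v = p` -/

/-- **TAME PLACES: `C_v = p`.**  For `p` odd and `e(v|p) ≤ p − 2` every `φ ∈ Real.ismDH (analyticLogv F) v` satisfies
`‖φ x‖ ≤ p · ‖x‖` (here `log_p(𝒪_v^×) = 𝔪_v`, `I_v = (p·ϖ_v)⁻¹… ` is a ball, and a `ℚ_p`-linear automorphism of a ball
inflates by less than `p`). [cite: DupuyHilado2025, §4.9] [claim: Mochizuki2012, status: disputed] -/
theorem norm_map_le_prime_mul_of_mem_ismDH_of_tame (hp : residueChar F v = p) (hp2 : 2 < p)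
    (he : absRamificationIdx p (RescaledCompletion F p v hv) ≤ p - 2)
    {φ : Carrier (.inr v : Place F) ≃ₗ[ℚ] Carrier (.inr v : Place F)}
    (hφ : φ ∈ ismDH (analyticLogv F) (.inr v : Place F)) (x : Carrier (.inr v : Place F)) :
    ‖RescaledCompletion.of F p v hv (φ x)‖ ≤ (p : ℝ) * ‖RescaledCompletion.of F p v hv x‖ := by
  have h := norm_map_le_pow_of_mem_ismDH p v hv hp hφ x
  rwa [one_add_logRadiusA_add_logRadiusB_eq_one_of_tame p hp2
    (absRamificationIdx_pos p (RescaledCompletion F p v hv)) he, Real.rpow_one] at h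

/-- **TAME PLACES, two-sided**: `‖x‖ ≤ p · ‖φ x‖` as well. [cite: DupuyHilado2025, §4.9] [claim: Mochizuki2012, status: disputed] -/
theorem norm_le_prime_mul_norm_map_of_mem_ismDH_of_tame (hp : residueChar F v = p) (hp2 : 2 < p)
    (he : absRamificationIdx p (RescaledCompletion F p v hv) ≤ p - 2)
    {φ : Carrier (.inr v : Place F) ≃ₗ[ℚ] Carrier (.inr v : Place F)}
    (hφ : φ ∈ ismDH (analyticLogv F) (.inr v : Place F)) (x : Carrier (.inr v : Place F)) :
    ‖RescaledCompletion.of F p v hv x‖ ≤ (p : ℝ) * ‖RescaledCompletion.of F p v hv (φ x)‖ := by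
  have h := norm_map_le_prime_mul_of_mem_ismDH_of_tame p v hv hp hp2 he (symm_mem_ismDH v hφ) (φ x)
  rwa [LinearEquiv.symm_apply_apply] at h

/-- **TAME PLACES, ball form**: every `φ ∈ Real.ismDH (analyticLogv F) v` maps `B(0,r)` into `B(0, p·r)`; in particular
so does every element of print's (Ind1) strip part and of print's (Ind2) (both inside `Real.ismDH`).
[cite: DupuyHilado2025, §4.9] [claim: Mochizuki2012, status: disputed] -/
theorem image_closedBall_subset_prime_mul_of_mem_ismDH_of_tame (hp : residueChar F v = p) (hp2 : 2 < p)
    (he : absRamificationIdx p (RescaledCompletion F p v hv) ≤ p - 2)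
    {φ : Carrier (.inr v : Place F) ≃ₗ[ℚ] Carrier (.inr v : Place F)}
    (hφ : φ ∈ ismDH (analyticLogv F) (.inr v : Place F)) (r : ℝ) :
    (fun y => RescaledCompletion.of F p v hv (φ ((RescaledCompletion.of F p v hv).symm y))) ''
        closedBall (0 : RescaledCompletion F p v hv) r ⊆
      closedBall (0 : RescaledCompletion F p v hv) ((p : ℝ) * r) := by
  have h := image_closedBall_subset_pow_of_mem_ismDH p v hv hp hφ r
  rwa [one_add_logRadiusA_add_logRadiusB_eq_one_of_tame p hp2
    (absRamificationIdx_pos p (RescaledCompletion F p v hv)) he, Real.rpow_one] at h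

/-! ## §4. The constant in print's currency `e(v|p) = v.asIdeal.ramificationIdx ℤ`; the uniform crude bound `C_v ≤ p⁴·e(v|p)` -/

/-- **The explicit bound in print's currency**: with `e(v|p) = v.asIdeal.ramificationIdx ℤ` (abc-iut-S7
`absRamificationIdx_rescaledCompletion`), `‖φ x‖ ≤ p^{1 + a_{e(v|p)} + b_{e(v|p)}} · ‖x‖` for every
`φ ∈ Real.ismDH (analyticLogv F) v`. [cite: DupuyHilado2025, §4.9] [claim: Mochizuki2012, status: disputed] -/
theorem norm_map_le_pow_ramificationIdx_of_mem_ismDH (hp : residueChar F v = p)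
    {φ : Carrier (.inr v : Place F) ≃ₗ[ℚ] Carrier (.inr v : Place F)}
    (hφ : φ ∈ ismDH (analyticLogv F) (.inr v : Place F)) (x : Carrier (.inr v : Place F)) :
    ‖RescaledCompletion.of F p v hv (φ x)‖ ≤
      (p : ℝ) ^ (1 + logRadiusA p (v.asIdeal.ramificationIdx ℤ) + logRadiusB p (v.asIdeal.ramificationIdx ℤ)) *
        ‖RescaledCompletion.of F p v hv x‖ := by
  rw [← absRamificationIdx_rescaledCompletion F p v hv]
  exact norm_map_le_pow_of_mem_ismDH p v hv hp hφ x

/-- **UNIFORM CRUDE BOUND `C_v ≤ p⁴ · e(v|p)`**: every `φ ∈ Real.ismDH (analyticLogv F) v` satisfies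
`‖φ x‖ ≤ p⁴ · e(v|p) · ‖x‖` — a bound polynomial in `p` and `e(v|p)`, uniform in `φ` and `x`; hence so do print's (Ind1)
strip part and print's (Ind2) at `v`. [cite: DupuyHilado2025, §4.9] [claim: Mochizuki2012, status: disputed] -/
theorem norm_map_le_prime_pow_four_mul_ramificationIdx_of_mem_ismDH (hp : residueChar F v = p)
    {φ : Carrier (.inr v : Place F) ≃ₗ[ℚ] Carrier (.inr v : Place F)}
    (hφ : φ ∈ ismDH (analyticLogv F) (.inr v : Place F)) (x : Carrier (.inr v : Place F)) :
    ‖RescaledCompletion.of F p v hv (φ x)‖ ≤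
      (p : ℝ) ^ (4 : ℕ) * (v.asIdeal.ramificationIdx ℤ : ℕ) * ‖RescaledCompletion.of F p v hv x‖ := by
  refine (norm_map_le_pow_ramificationIdx_of_mem_ismDH p v hv hp hφ x).trans ?_
  exact mul_le_mul_of_nonneg_right
    (pow_one_add_logRadiusA_add_logRadiusB_le p (Ideal.ramificationIdx_pos _ _)) (norm_nonneg _)

/-- **TAME PLACES in print's currency**: `p` odd and `e(v|p) ≤ p − 2` ⇒ `‖φ x‖ ≤ p · ‖x‖` for every
`φ ∈ Real.ismDH (analyticLogv F) v`. [cite: DupuyHilado2025, §4.9] [claim: Mochizuki2012, status: disputed] -/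
theorem norm_map_le_prime_mul_of_mem_ismDH_of_ramificationIdx_le (hp : residueChar F v = p) (hp2 : 2 < p)
    (he : v.asIdeal.ramificationIdx ℤ ≤ p - 2)
    {φ : Carrier (.inr v : Place F) ≃ₗ[ℚ] Carrier (.inr v : Place F)}
    (hφ : φ ∈ ismDH (analyticLogv F) (.inr v : Place F)) (x : Carrier (.inr v : Place F)) :
    ‖RescaledCompletion.of F p v hv (φ x)‖ ≤ (p : ℝ) * ‖RescaledCompletion.of F p v hv x‖ :=
  norm_map_le_prime_mul_of_mem_ismDH_of_tame p v hv hp hp2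
    ((absRamificationIdx_rescaledCompletion F p v hv).le.trans he) hφ x

end Explicit

end Summit.ABC.IUTFork.Thm311.Real

end
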